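import Literature.AnabelianGeometry.SemiGraphs.CosetCategoriesEquivalence
import Literature.IUT.HodgeTheaters.InitialThetaDataLocalConjugacy
import Literature.IUT.HodgeTheaters.InitialThetaDataGoodLocalFrobenioid
import HarnessLib

/-!
# [IUTchI] Example 3.3 (i) at the datum: `D_v̲ = 𝓑(Π_v̲)⁰` does not depend on the embedding `F̄ ↪ K̄_v̲`, up to
# equivalence of categories

S. Mochizuki, *Inter-universal Teichmüller theory I*, §3, Def. 3.1 (e) p. 63 ("`G_v̲ ⊆ G_K` determined, up to
`G_K`-conjugacy, by `v̲`"), Example 3.3 (i) p. 77 ("`D_v := 𝓑(X̲→_v̲)⁰` … `D⊢_v := 𝓑(K_v̲)⁰`") (kurims manuscript, May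
2020) [claim: Mochizuki2012, status: disputed].

PROOF-ONLY (theorems only; no definitions, no instances), joining `InitialThetaDataLocalConjugacy` (`Π_{H,v̲}` for two
`K`-embeddings `ι, ι' : F̄ → Ω` are conjugate by `(t⁻¹, 1)`, `t ∈ H`, when `H ↠ G_K`) with `CosetCategoriesEquivalence`
(conjugate subgroups have equivalent coset categories):
* `nonempty_equivalence_cosetCat_PiLoc_of_embeddings` — `𝓑(Π_{H,v̲}(ι))⁰ ≌ 𝓑(Π_{H,v̲}(ι'))⁰` for every `H ⊆ Π_{C_F}`
  with `G_K ⊆ augGF(H)`; in particular for `Π_v̲ := Π_{X̲→_v̲}` (`…_PiXarrow_…`) and `Π_{C_v̲}` (`…_PiCK_…`);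
* `nonempty_equivalence_Dv_goodLocalFrobenioidOfEmb` — the base category `D_v̲` of [IUTchI] Ex. 3.3 (i)(ii) AT THE
  DATUM (`goodLocalFrobenioidOfEmb D p k ι hX`, abc-iut-L5-t2 p419029) for two embeddings: EQUIVALENT categories
  (and `D⊢_v̲ = 𝓑(Gal(k̄/k))⁰` is literally the same), i.e. the construction is canonical up to equivalence, as print's
  "outer" / "up to `G_K`-conjugacy" requires.
Nothing of the series is asserted; no side is taken.
-/

noncomputable section

namespace Literature.IUT.HodgeTheaters

open Literature.AnabelianGeometry.SemiGraphs
open scoped Pointwise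

universe u v w w'

namespace InitialThetaData

section Embeddings

variable {F : Type u} {K : Type v} {Fbar : Type w} [Field F] [NumberField F] [Field K] [NumberField K]
  [Algebra F K] [Field Fbar] [Algebra F Fbar] [Algebra K Fbar] [IsScalarTower F K Fbar] [Normal K Fbar]
  {E : WeierstrassCurve F} [E.IsElliptic] {l : ℕ} {Pb : BadPlacePredicates K}
  (D : InitialThetaData F K Fbar E l Pb)
  {Ω : Type w'} [Field Ω] [Algebra K Ω]
  (k : Type w') [Field k] [Algebra K k] [Algebra k Ω] [IsScalarTower K k Ω] (ι ι' : Fbar →ₐ[K] Ω)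

/-- **`𝓑(Π_{H,v̲})⁰` is independent of the embedding up to equivalence**: for `H ⊆ Π_{C_F}` with `G_K ⊆ augGF(H)` and two
`K`-embeddings `ι, ι' : F̄ → Ω`, the coset categories of the base changes `Π_{H,v̲}(ι)`, `Π_{H,v̲}(ι')` are equivalent
(they are conjugate subgroups of `Π_{C_F} × Gal(Ω/k)`). [claim: Mochizuki2012, status: disputed] -/
theorem nonempty_equivalence_cosetCat_PiLoc_of_embeddings {H : Subgroup D.PiC}
    (hH : galoisSubgroupOf F K Fbar ≤ H.map D.augGF) :
    Nonempty (CosetCat (D.PiLoc H (localToGF F k ι)) ≌ CosetCat (D.PiLoc H (localToGF F k ι'))) := by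
  obtain ⟨t, -, h⟩ := D.exists_PiLoc_eq_conj_of_embeddings k ι ι' hH
  rw [h]
  obtain ⟨e⟩ := CosetCat.nonempty_equivalence_of_conj (D.PiLoc H (localToGF F k ι))
    ((t⁻¹, 1) : D.PiC × (Ω ≃ₐ[k] Ω))
  exact ⟨e.symm⟩

/-- **`𝓑(Π_v̲)⁰`, `Π_v̲ := Π_{X̲→_v̲}`, is independent of the embedding up to equivalence** (`Π_{X̲→_K} ↠ G_K`).
[claim: Mochizuki2012, status: disputed] -/
theorem nonempty_equivalence_cosetCat_PiLoc_PiXarrow_of_embeddings :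
    Nonempty (CosetCat (D.PiLoc D.PiXarrow (localToGF F k ι)) ≌ CosetCat (D.PiLoc D.PiXarrow (localToGF F k ι'))) :=
  D.nonempty_equivalence_cosetCat_PiLoc_of_embeddings k ι ι' D.galoisSubgroupOf_le_map_PiXarrow

/-- `𝓑(Π_{C_v̲})⁰` (the ambient of the local §1 datum) is independent of the embedding up to equivalence.
[claim: Mochizuki2012, status: disputed] -/
theorem nonempty_equivalence_cosetCat_PiLoc_PiCK_of_embeddings :
    Nonempty (CosetCat (D.PiLoc D.PiCK (localToGF F k ι)) ≌ CosetCat (D.PiLoc D.PiCK (localToGF F k ι'))) :=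
  D.nonempty_equivalence_cosetCat_PiLoc_of_embeddings k ι ι' (D.galoisSubgroupOf_le_map_of_PiXund_le D.PiXund_le_PiCK)

end Embeddings

/-! ### Example 3.3 (i) at the datum: `D_v̲` for two embeddings `F̄ ↪ k̄` -/

section Example33

variable {F : Type u} {K : Type v} {Fbar : Type} [Field F] [NumberField F] [Field K] [NumberField K]
  [Algebra F K] [Field Fbar] [Algebra F Fbar] [Algebra K Fbar] [IsScalarTower F K Fbar] [Normal K Fbar]
  {E : WeierstrassCurve F} [E.IsElliptic] {l : ℕ} {Pb : BadPlacePredicates K}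
  (D : InitialThetaData F K Fbar E l Pb) (p : ℕ) [Fact p.Prime]
  (k : Type) [NontriviallyNormedField k] [CompleteSpace k] [IsUltrametricDist k] [NormedAlgebra ℚ_[p] k]
  [FiniteDimensional ℚ_[p] k] [Algebra K k] (ι ι' : Fbar →ₐ[K] AlgebraicClosure k)

/-- **[IUTchI] Example 3.3 (i) at the datum: the base category `D_v̲ = 𝓑(Π_v̲)⁰` of `goodLocalFrobenioidOfEmb D p k ι hX`
does not depend on the `K`-embedding `ι : F̄ → k̄` up to EQUIVALENCE**: both `D_v̲` ARE the coset categories of the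
respective `Π_v̲` (`goodLocalFrobenioidOfEmb_bases`, by name), these are equivalent (the two `Π_v̲` are conjugate by an
element of `Π_{X̲→_K} × 1`), and `D⊢_v̲ = 𝓑(Gal(k̄/k))⁰` is the same category for both.
[claim: Mochizuki2012, status: disputed] -/
theorem nonempty_equivalence_Dv_goodLocalFrobenioidOfEmb (hX : IsOpen (D.PiXarrow : Set D.PiC)) :
    @GoodLocalFrobenioid.Dv p k _ (GaloisValDatum.normVal k) (D.goodLocalFrobenioidOfEmb p k ι hX) =
        CosetCat (D.PiLoc D.PiXarrow (localToGF F k ι)) ∧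
      @GoodLocalFrobenioid.Dv p k _ (GaloisValDatum.normVal k) (D.goodLocalFrobenioidOfEmb p k ι' hX) =
        CosetCat (D.PiLoc D.PiXarrow (localToGF F k ι')) ∧
      Nonempty (CosetCat (D.PiLoc D.PiXarrow (localToGF F k ι)) ≌
        CosetCat (D.PiLoc D.PiXarrow (localToGF F k ι'))) ∧
      @GoodLocalFrobenioid.Ddash p k _ (GaloisValDatum.normVal k) (D.goodLocalFrobenioidOfEmb p k ι hX) =
        @GoodLocalFrobenioid.Ddash p k _ (GaloisValDatum.normVal k) (D.goodLocalFrobenioidOfEmb p k ι' hX) := by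
  obtain ⟨h1, h2⟩ := D.goodLocalFrobenioidOfEmb_bases p k ι hX
  obtain ⟨h1', h2'⟩ := D.goodLocalFrobenioidOfEmb_bases p k ι' hX
  exact ⟨h1, h1', D.nonempty_equivalence_cosetCat_PiLoc_PiXarrow_of_embeddings k ι ι', h2.trans h2'.symm⟩

end Example33

end InitialThetaData

end Literature.IUT.HodgeTheaters

end
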